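import Literature.NumberTheory.GaloisRepresentations.LocalMuCocycleSubgroupSplitting
import Mathlib.GroupTheory.PGroup
import HarnessLib

/-!
# A `μ_N`-valued `2`-cocycle of a local field splits on every open subgroup of index divisible by `N`;
# the layers of a non-trivial `ψ : G → ℤ_p` have index divisible by `p^k` for large `m`
# (Serre, *Corps locaux* XIII §3 Prop. 7; *Cohomologie galoisienne* II §3.3 Prop. 9, II §4.4 Lemme 1)

Topic `NumberTheory/GaloisRepresentations`; namespace `Literature.NumberTheory.GaloisRepresentations`.
Theorems only (no definition, no named fact; D-0026).  The `N`-torsion versions of the tree's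
`exists_contTwoCocycles_mu_subgroup_eq` / `exists_cob_on_subgroup_of_pow_eq_one_of_dvd_index`
(`LocalMuCocycleSubgroupSplitting.lean`, there for a prime `p`) and the `p^k`-version of
`exists_dvd_index_comap_span_pow_of_apply_ne_one` (`CyclotomicTowerLocalIndex.lean`, there `p ∣`):

* `exists_contTwoCocycles_muN_subgroup_eq` — a locally constant `2`-cocycle `e : Γ_F × Γ_F → F̄ˣ`
  with `e(σ,τ)^N = 1` defines a continuous cocycle of `μ_N` over any closed `S ≤ Γ_F` (dictionary);
* `exists_cob_on_subgroup_of_pow_eq_one_of_dvd_index'` — **for a non-archimedean local field `F`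
  of characteristic `0`, such an `e` is, on every open `U ≤ Γ_F` with `N ∣ (Γ_F : U)`, the coboundary
  of a locally constant cochain `b : U → F̄ˣ`** (Serre XIII §3 Prop. 7: `Br(F)[N] → Br(L)` vanishes
  when `N ∣ [L : F]`; tree `resSub_two_mu_eq_zero_of_dvd_relIndex`);
* `exists_pow_dvd_index_comap_span_pow_of_apply_ne_one` — for a compact group `G` and a continuous
  `ψ : G → ℤ_p` with a value `ψ σ ≠ 0` (of valuation `s`), **`p^k ∣ (G : ψ⁻¹(p^m ℤ_p))` for all
  `m ≥ s + k`** (the class of `σ` in the finite `p`-group `G/ψ⁻¹(p^m ℤ_p)` has order `p^{m-s}`);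
  Serre II §4.4 Lemme 1: the local degrees in a `ℤ_p`-tower in which the place does not split
  completely are unbounded powers of `p`.

These are the local inputs of the killing of `H²(Γ_K, μ_N)` along the cyclotomic `ℤ_p`-tower
(`CyclotomicTowerMuKilling.lean`), hence of the tree's discharge of
`poitouTate_sum_localTatePairing_eq_zero`.

## References

* J.-P. Serre, *Corps locaux*, Hermann, 1968, XIII §3 Prop. 7 and Cor. 3. [SerreLocalFields1979]
* J.-P. Serre, *Cohomologie galoisienne* / *Galois Cohomology* (1997), II §3.3 Prop. 9, II §4.4
  Prop. 13 and Lemme 1. [SerreGaloisCohomology1997]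
-/

noncomputable section

open CategoryTheory Function
open Field IntermediateField

universe u

namespace Literature.NumberTheory.GaloisRepresentations

open _root_.TopRep _root_.ContRepresentation _root_.ContinuousCohomology DiscreteGaloisModule
open LocalWeilDatum

/-! ### Dictionary: `μ_N`-valued explicit cocycles as continuous cocycles of `μ_N` -/

section AnyField

variable (F : Type u) [Field F] {N : ℕ}

/-- **A locally constant `μ_N`-valued `2`-cocycle `e : Γ_F × Γ_F → F̄ˣ` defines a continuous
`2`-cocycle of the discrete module `μ_N` restricted to a closed subgroup `S ≤ Γ_F`**, with values
`e(x,y)` (the tree's `exists_contTwoCocycles_mu_subgroup_eq` with the prime `p` replaced by any `N`).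
[cite: SerreGaloisCohomology1997, I §2.2–2.3, II §1.2] -/
theorem exists_contTwoCocycles_muN_subgroup_eq (S : Subgroup (absoluteGaloisGroup F))
    [IsClosed (S : Set (absoluteGaloisGroup F))]
    (e : absoluteGaloisGroup F → absoluteGaloisGroup F → (AlgebraicClosure F)ˣ)
    (hlc : IsLocallyConstant fun q : absoluteGaloisGroup F × absoluteGaloisGroup F => e q.1 q.2)
    (hcoc : ∀ σ τ υ, e σ τ * e (σ * τ) υ = σ • e τ υ * e σ (τ * υ))
    (hep : ∀ σ τ, e σ τ ^ N = 1) :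
    ∃ c : contTwoCocycles ((mu F N).restrict (subgroupIncl S)).toTopRep,
      ∀ x y : S, ((MuCarrier.toAdditive (c.1 (x, y))).toMul : (AlgebraicClosure F)ˣ) = e x y := by
  haveI := absoluteGaloisGroup_compactSpace F
  let ζ : absoluteGaloisGroup F → absoluteGaloisGroup F → rootsOfUnity N (AlgebraicClosure F) :=
    fun σ τ => ⟨e σ τ, by rw [mem_rootsOfUnity]; exact hep σ τ⟩
  have hζ : ∀ σ τ, ((ζ σ τ : rootsOfUnity N (AlgebraicClosure F)) : (AlgebraicClosure F)ˣ) = e σ τ :=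
    fun _ _ => rfl
  let f₀ : S × S → MuCarrier F N := fun q => MuCarrier.ofRootsOfUnity (ζ q.1 q.2)
  have hf₀lc : IsLocallyConstant f₀ := by
    have h1 : IsLocallyConstant fun q : S × S => e q.1 q.2 :=
      hlc.comp_continuous (f := fun q : S × S => ((q.1 : absoluteGaloisGroup F), (q.2 : absoluteGaloisGroup F)))
        (by fun_prop)
    refine (IsLocallyConstant.iff_exists_open _).2 fun q => ?_
    obtain ⟨U, hU, hqU, hconst⟩ := (IsLocallyConstant.iff_exists_open _).1 h1 q
    refine ⟨U, hU, hqU, fun q' hq' => ?_⟩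
    have h2 := hconst q' hq'
    change MuCarrier.ofRootsOfUnity (ζ q'.1 q'.2) = MuCarrier.ofRootsOfUnity (ζ q.1 q.2)
    congr 1
    exact Subtype.ext (Units.ext (by rw [hζ, hζ]; exact congrArg (fun u : (AlgebraicClosure F)ˣ => (u : AlgebraicClosure F)) h2))
  let f : C(S × S, MuCarrier F N) := ⟨f₀, hf₀lc.continuous⟩
  have hfval : ∀ x y : S, ((MuCarrier.toAdditive (f (x, y))).toMul : (AlgebraicClosure F)ˣ) = e x y :=
    fun _ _ => rfl
  refine ⟨⟨f, fun x y w => ?_⟩, hfval⟩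
  apply MuCarrier.toAdditive.injective
  apply Additive.toMul.injective
  apply Subtype.ext
  change ((x : absoluteGaloisGroup F) • e y w) * e x (y * w) = e (x * y) w * e x y
  rw [← hcoc, mul_comm]

end AnyField

/-! ### Local fields: splitting on open subgroups of index divisible by `N` -/

section Local

variable (F : Type u) [Field F] [ValuativeRel F] [TopologicalSpace F] [IsNonarchimedeanLocalField F]
  [CharZero F] {N : ℕ} [NeZero N]

/-- **A `μ_N`-valued locally constant `2`-cocycle of a local field is a coboundary on every open
subgroup of index divisible by `N`** (the tree's `exists_cob_on_subgroup_of_pow_eq_one_of_dvd_index`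
for any `N ≥ 1` in place of a prime): `U = Gal(F̄/L)` with `N ∣ [L : F]`, and the class of `e` in
`H²(Γ_F, μ_N)` dies on `Gal(F̄/L)` by Serre XIII §3 Prop. 7 (`resSub_two_mu_eq_zero_of_dvd_relIndex`).
[cite: SerreLocalFields1979, XIII §3 Prop. 7 and Cor. 3] [cite: SerreGaloisCohomology1997, II §3.3 Prop. 9] -/
theorem exists_cob_on_subgroup_of_pow_eq_one_of_dvd_index'
    (e : absoluteGaloisGroup F → absoluteGaloisGroup F → (AlgebraicClosure F)ˣ)
    (hlc : IsLocallyConstant fun q : absoluteGaloisGroup F × absoluteGaloisGroup F => e q.1 q.2)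
    (hcoc : ∀ σ τ υ, e σ τ * e (σ * τ) υ = σ • e τ υ * e σ (τ * υ))
    (hep : ∀ σ τ, e σ τ ^ N = 1)
    (U : Subgroup (absoluteGaloisGroup F)) (hU : IsOpen (U : Set (absoluteGaloisGroup F)))
    (hNU : N ∣ U.index) :
    ∃ b : U → (AlgebraicClosure F)ˣ, IsLocallyConstant b ∧
      ∀ x y : U, e x y = b x * (x : absoluteGaloisGroup F) • b y / b (x * y) := by
  classical
  haveI := absoluteGaloisGroup_compactSpace F
  obtain ⟨L, hLfin, hL⟩ := exists_galFixing_eq_of_isOpen U hU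
  haveI := hLfin
  subst hL
  haveI : IsClosed ((galFixing F L : Subgroup (absoluteGaloisGroup F)) : Set (absoluteGaloisGroup F)) :=
    isClosed_galFixing' F L
  haveI : IsClosed ((galFixing F (⊥ : IntermediateField F (AlgebraicClosure F)) :
      Subgroup (absoluteGaloisGroup F)) : Set (absoluteGaloisGroup F)) := isClosed_galFixing' F ⊥
  haveI : CompactSpace (galFixing F L) := compactSpace_of_isClosed_subgroup
  haveI : CompactSpace (galFixing F (⊥ : IntermediateField F (AlgebraicClosure F))) :=
    compactSpace_of_isClosed_subgroup
  obtain ⟨c, hc⟩ := exists_contTwoCocycles_muN_subgroup_eq F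
    (galFixing F (⊥ : IntermediateField F (AlgebraicClosure F))) e hlc hcoc hep
  have hNd : N ∣ (galFixing F L).relIndex (galFixing F (⊥ : IntermediateField F (AlgebraicClosure F))) := by
    rw [galFixing_bot, Subgroup.relIndex_top_right]
    exact hNU
  have hres := resSub_two_mu_eq_zero_of_dvd_relIndex F ⊥ L bot_le (NeZero.pos N) hNd (twoCocycleClass _ c)
  rw [resSub, map_twoCocycleClass, twoCocycleClass_eq_zero_iff] at hres
  obtain ⟨b, hb⟩ := hres
  refine ⟨fun x => ((MuCarrier.toAdditive (b x)).toMul : (AlgebraicClosure F)ˣ),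
    (((IsLocallyConstant.iff_continuous b).2 b.continuous).comp _), fun x y => ?_⟩
  have key := hb x y
  rw [contTwoCocycles.pullback_apply, resSubMod_hom_apply] at key
  simp only [ContinuousRep.toContRepresentation_apply_apply, ContinuousRep.restrict_apply,
    subgroupIncl_apply] at key
  have hcxy := hc (inclHom (galFixing_antitone F (bot_le : (⊥ : IntermediateField F (AlgebraicClosure F)) ≤ L)) x)
    (inclHom (galFixing_antitone F (bot_le : (⊥ : IntermediateField F (AlgebraicClosure F)) ≤ L)) y)
  rw [key, map_add, map_sub, mu_apply_apply, toMul_add, toMul_sub, toMul_ofMul, Subgroup.coe_mul,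
    Subgroup.coe_div, absoluteGaloisGroup.coe_smul_rootsOfUnity] at hcxy
  change _ = e x y at hcxy
  rw [← hcxy]
  beta_reduce
  rw [mul_comm, mul_div_assoc]

end Local

/-! ### Abstract: the layers `ψ⁻¹(p^m ℤ_p)` have index divisible by `p^k` for large `m` -/

section Abstract

variable {G : Type u} [Group G] [TopologicalSpace G]
  {p : ℕ} [hp : Fact p.Prime] (ψ : G →ₜ* Multiplicative ℤ_[p])

/-- Membership in `ψ⁻¹(p^m ℤ_p)`: `p^m ∣ ψ σ`. [folklore] -/
private theorem mem_comap_span_pow_iff'' (m : ℕ) (σ : G) :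
    σ ∈ (AddSubgroup.toSubgroup (Ideal.span {(p : ℤ_[p]) ^ m}).toAddSubgroup).comap ψ.toMonoidHom ↔
      (p : ℤ_[p]) ^ m ∣ (ψ σ).toAdd := by
  rw [Subgroup.mem_comap, Multiplicative.mem_toSubgroup, Submodule.mem_toAddSubgroup,
    Ideal.mem_span_singleton]
  rfl

/-- `ψ⁻¹(p^m ℤ_p)` is open. [folklore] -/
private theorem isOpen_comap_span_pow'' (m : ℕ) :
    IsOpen (((AddSubgroup.toSubgroup (Ideal.span {(p : ℤ_[p]) ^ m}).toAddSubgroup).comap ψ.toMonoidHom :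
      Subgroup G) : Set G) := by
  have hball : ((Ideal.span {(p : ℤ_[p]) ^ m} : Ideal ℤ_[p]) : Set ℤ_[p]) =
      Metric.closedBall (0 : ℤ_[p]) ((p : ℝ) ^ (-m : ℤ)) := by
    ext x
    rw [SetLike.mem_coe, Metric.mem_closedBall, dist_zero_right, PadicInt.norm_le_pow_iff_mem_span_pow]
  have hopen : IsOpen ((Ideal.span {(p : ℤ_[p]) ^ m} : Ideal ℤ_[p]) : Set ℤ_[p]) := by
    rw [hball]
    refine IsUltrametricDist.isOpen_closedBall _ (zpow_ne_zero _ ?_)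
    exact_mod_cast hp.out.ne_zero
  exact hopen.preimage (map_continuous ψ)

/-- **The layers `ψ⁻¹(p^m ℤ_p)` of a non-trivial continuous `ψ : G → ℤ_p` on a compact group have
index divisible by `p^k` for all large `m`** (Serre II §4.4 Lemme 1; Washington §13.1: the local
degrees in a `ℤ_p`-tower where the place does not split completely are unbounded powers of `p`): if
`ψ σ ≠ 0` has valuation `s`, then for `m ≥ s + k` the class of `σ` in the finite group
`G / ψ⁻¹(p^m ℤ_p)` has order `p^{m-s}`, a multiple of `p^k`.
[cite: SerreGaloisCohomology1997, II §4.4 Prop. 13 (Lemme 1)] -/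
theorem exists_pow_dvd_index_comap_span_pow_of_apply_ne_one [IsTopologicalGroup G] [CompactSpace G]
    (hψ : ∃ σ, ψ σ ≠ 1) (k : ℕ) :
    ∃ m₀ : ℕ, ∀ m, m₀ ≤ m →
      p ^ k ∣ ((AddSubgroup.toSubgroup (Ideal.span {(p : ℤ_[p]) ^ m}).toAddSubgroup).comap ψ.toMonoidHom).index := by
  classical
  obtain ⟨σ, hσ⟩ := hψ
  have hσ' : (ψ σ).toAdd ≠ 0 := fun h => hσ (by rw [← ofAdd_toAdd (ψ σ), h, ofAdd_zero])
  set s : ℕ := ((ψ σ).toAdd).valuation with hs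
  set S : ℕ → Subgroup G := fun m =>
    (AddSubgroup.toSubgroup (Ideal.span {(p : ℤ_[p]) ^ m}).toAddSubgroup).comap ψ.toMonoidHom with hS
  refine ⟨s + k, fun m hm => ?_⟩
  change p ^ k ∣ (S m).index
  haveI hSn : (S m).Normal := by
    change ((AddSubgroup.toSubgroup (Ideal.span {(p : ℤ_[p]) ^ m}).toAddSubgroup).comap ψ.toMonoidHom).Normal
    exact Subgroup.Normal.comap inferInstance _
  haveI : Finite (G ⧸ S m) := Subgroup.quotient_finite_of_isOpen _ (isOpen_comap_span_pow'' ψ m)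
  -- membership of powers of `σ` in the layer
  have hmem : ∀ j : ℕ, σ ^ j ∈ S m ↔ (p : ℤ_[p]) ^ m ∣ (j : ℤ_[p]) * (ψ σ).toAdd := fun j => by
    change σ ^ j ∈ (AddSubgroup.toSubgroup (Ideal.span {(p : ℤ_[p]) ^ m}).toAddSubgroup).comap ψ.toMonoidHom ↔ _
    rw [mem_comap_span_pow_iff'', map_pow, toAdd_pow, nsmul_eq_mul]
  obtain ⟨n, hn⟩ : ∃ n : ℕ, m = s + (n + 1) + (k - 1) ∨ (k = 0) := by
    rcases Nat.eq_zero_or_pos k with hk | hk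
    · exact ⟨0, Or.inr hk⟩
    · refine ⟨m - s - k, Or.inl ?_⟩; omega
  rcases hn with hmn | hk0
  swap
  · rw [hk0, pow_zero]; exact one_dvd _
  -- the order of `[σ]` in `G / S m` is `p ^ (n + 1 + (k - 1)) = p ^ (m - s)`
  set t : ℕ := n + (k - 1) with ht
  have hmst : m = s + (t + 1) := by omega
  have hp0 : (p : ℤ_[p]) ≠ 0 := by exact_mod_cast hp.out.ne_zero
  have hval : ∀ j : ℕ, ((p : ℤ_[p]) ^ j * (ψ σ).toAdd).valuation = j + s := fun j => by
    rw [PadicInt.valuation_p_pow_mul j _ hσ']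
  have hpow_mem : σ ^ p ^ (t + 1) ∈ S m := by
    rw [hmem, Nat.cast_pow, ← Ideal.mem_span_singleton,
      PadicInt.mem_span_pow_iff_le_valuation _ (mul_ne_zero (pow_ne_zero _ hp0) hσ'), hval]
    omega
  have hpow_not : σ ^ p ^ t ∉ S m := by
    rw [hmem, Nat.cast_pow, ← Ideal.mem_span_singleton,
      PadicInt.mem_span_pow_iff_le_valuation _ (mul_ne_zero (pow_ne_zero _ hp0) hσ'), hval]
    omega
  have horder : orderOf (QuotientGroup.mk (s := S m) σ) = p ^ (t + 1) := by
    refine orderOf_eq_prime_pow ?_ ?_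
    · rw [← QuotientGroup.mk_pow, QuotientGroup.eq_one_iff]; exact hpow_not
    · rw [← QuotientGroup.mk_pow, QuotientGroup.eq_one_iff]; exact hpow_mem
  rw [Subgroup.index_eq_card]
  have hdvd : p ^ (t + 1) ∣ Nat.card (G ⧸ S m) := horder ▸ orderOf_dvd_natCard _
  exact (pow_dvd_pow p (by omega : k ≤ t + 1)).trans hdvd

end Abstract

/-! ### Number fields: local layers of a `ℤ_p`-character have index divisible by `p^k` -/

section NumberField

open NumberField IsDedekindDomain

variable (K : Type) [Field K] [NumberField K] (p : ℕ) [hp : Fact p.Prime]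

/-- **Local layers of index divisible by `p^k`**: for a continuous `φ : Γ_K → ℤ_p` non-trivial on
the decomposition group at the finite place `v`, the subgroups `res_v⁻¹(φ⁻¹(p^m ℤ_p)) ≤ Γ_{K_v}`
have index divisible by `p^k` for all large `m` (the `p^k`-form of the tree's
`exists_dvd_index_comap_resGal_of_ne_one`). [cite: SerreGaloisCohomology1997, II §4.4 Prop. 13 (Lemme 1)] -/
theorem exists_pow_dvd_index_comap_resGal_of_ne_one (φ : absoluteGaloisGroup K →ₜ* Multiplicative ℤ_[p])
    (v : HeightOneSpectrum (𝓞 K))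
    (hφ : ∃ σ : absoluteGaloisGroup (v.adicCompletion K), φ (absGaloisRestrict K (v.adicCompletion K) σ) ≠ 1)
    (k : ℕ) :
    ∃ m₀ : ℕ, ∀ m, m₀ ≤ m →
      p ^ k ∣ (((AddSubgroup.toSubgroup (Ideal.span {(p : ℤ_[p]) ^ m}).toAddSubgroup).comap φ.toMonoidHom).comap
        ((absGaloisRestrict K (v.adicCompletion K) :
          absoluteGaloisGroup (v.adicCompletion K) →ₜ* absoluteGaloisGroup K) :
            absoluteGaloisGroup (v.adicCompletion K) →* absoluteGaloisGroup K)).index := by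
  haveI := absoluteGaloisGroup_compactSpace (v.adicCompletion K)
  set ψ : absoluteGaloisGroup (v.adicCompletion K) →ₜ* Multiplicative ℤ_[p] :=
    φ.comp (absGaloisRestrict K (v.adicCompletion K)) with hψ
  obtain ⟨m₀, hm₀⟩ := exists_pow_dvd_index_comap_span_pow_of_apply_ne_one ψ hφ k
  refine ⟨m₀, fun m hm => ?_⟩
  rw [Subgroup.comap_comap]
  exact hm₀ m hm

end NumberField

end Literature.NumberTheory.GaloisRepresentations

end
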